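import Literature.AlgebraicGeometry.AbelianSchemes.SerreCoverRowsAtPoint       -- ★ p850688 (LA4-p01): `coverKer_rows_readAt` (GLOBAL rows ⇒ POINT rows); re-exports ★ `coverKer_transport_along_iso`, ★ `DualPair.baseChangeHom_dualIsogenyOver_base`, ★ `map_restrictPt_section_eq_of_baseChange_σ_comp(₂)`, ★ `sectionBaseChange_comp_baseChangeHom`
import Literature.AlgebraicGeometry.AbelianSchemes.TupleIsoPointCriteria       -- ★ `exists_iso_of_tupleRel_id`; re-exports ★ `tupleRel_baseChangeCompGrpIso_inv`
import HarnessLib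

/-!
# The GLOBAL Serre-cover rows of `c : 𝒜 → ℬ` over `Y`, with `ℬ ≅ 𝒜₂ ×_{Y₂} π` EXACTLY for `π : Y → Y₂`, READ AT A FIELD POINT `ℓ` as rows `𝒜_ℓ → (𝒜₂)_{ℓ ≫ π}`

Topic `AlgebraicGeometry/AbelianSchemes`; namespace `Literature.AlgebraicGeometry.AbelianSchemes.AbelianSchemeOver`.  THEOREMS ONLY (no definition,
no named fact, no instance, no notation, no `sorry`); universe-polymorphic.  Cell `hodgecm-mathlib` (D-0151), P6 «MOD programme» (crux hLiu418 =
stmt-HodgeConjecture-24832, `--supports`, count-neutral), line «L4», ROAD OF RECORD (γ′) «Serre tensor OVER `X`, classified» (LA4-plan (g2) 2026-09-02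
08:48:23Z ∕ DEAL #39 «GLOBAL ROWS ⇒ POINT ROWS» 08:59:40Z): over `X := Sh_K ⊗_F Fᵢ` the twisted family `ℬ := P ⊗_{𝒪_F} 𝔞⁻¹` receives the Serre cover
`c : P → ℬ` with its rows (t1)(t1′)(t2)(t3)(t4)(t5) GLOBALLY, and fine moduli give a GLOBAL exact isomorphism `E : ℬ ≅ P ×_X (1 × Spec γ)`; the sheet
statement wants, at every complex point `z`, the rows between the fibres `P_{ℓ_{τE}(z)}` and `P_{ℓ_{τE∘γ}(z)} = (P ×_X (1 × Spec γ))_{ℓ_{τE}(z)}`.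

THE MATHEMATICS ([MumfordFogartyKirwan1994] Ch. 6 §1 Cor. 6.8, Ch. 7 §2 Def. 7.2–7.3; [GortzWedhorn2020] (4.7), (4.15)–(4.16): base change is functorial and
transitive, `(𝒜₂ ×_{Y₂} π) ×_Y ℓ ≅ 𝒜₂ ×_{Y₂} (ℓ ≫ π)` compatibly with every datum; [Shimura1998] §13.1 Thm. 1 ∕ §18.6: the Serre cover and its rows).
Given the GLOBAL rows of `c : 𝒜 → ℬ` over `Y` and a GLOBAL isomorphism of group schemes `E : ℬ ≅ 𝒜₂ ×_{Y₂} π` exact on the polarisations (dual-homomorphism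
form), on the `O`-actions and on the basis sections, the composite `𝒜 ×_Y ℓ —c×ℓ→ ℬ ×_Y ℓ —E×ℓ→ (𝒜₂ ×_{Y₂} π) ×_Y ℓ ≅ 𝒜₂ ×_{Y₂} (ℓ ≫ π)` carries the SEVEN
point rows (kernel clause included) in the readers of `𝒜` at `ℓ` and of `𝒜₂` at `ℓ ≫ π`.  PROOF = ★ `coverKer_rows_readAt` (read `c` at `ℓ`) ∘ ★
`coverKer_transport_along_iso` TWICE (along `E ×_Y ℓ`, exactness base-changed by functoriality and ★ `DualPair.baseChangeHom_dualIsogenyOver_base`; then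
along the exact comparison isomorphism of ★ `exists_iso_of_tupleRel_id` ∘ ★ `tupleRel_baseChangeCompGrpIso_inv`), level points by ★
`map_restrictPt_section_eq_of_baseChange_σ_comp(₂)`, Poincaré pins by ★ `DualPair.nonempty_unitHatSlice_baseChange_iso`.

CONTENTS: §1 `coverKer_rows_readAt_of_iso_baseChange` (seven clauses).  USE (Lines `F0P6aGlobalSheetRows.coverKerBody_sheet_of_global_rows`, LA4-p01 (g3)):
`Y = Y₂ := X`, `𝒜 = 𝒜₂ := P.A`, `π := GaloisDescent.gal Fᵢ Sh_K γ⁻¹`, `ℓ := ℓ_{τE}(z)`, and the sheet law `ℓ_{τE}(z) ≫ π = ℓ_{τE∘γ}(z)`.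

References (metadata in `HarnessLib/References.lean`):
* [MumfordFogartyKirwan1994] D. Mumford, J. Fogarty, F. Kirwan, *Geometric Invariant Theory*, 3rd ed. (1994), Ch. 6 §1 Cor. 6.8 (p. 118); Ch. 7 §2 Def. 7.2 (p. 129), Def. 7.3 (p. 130).
* [GortzWedhorn2020] U. Görtz, T. Wedhorn, *Algebraic Geometry I*, 2nd ed. (2020), Section (4.7) (pp. 107–108), (4.15)–(4.16) (pp. 116–117).
* [Shimura1998] G. Shimura, *Abelian Varieties with Complex Multiplication and Modular Functions* (1998), §13.1 Theorem 1 (pp. 97–99), §18.6 (pp. 124–127).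
-/

set_option autoImplicit false

noncomputable section

-- Mathlib's `Over`/pull-back API is stated across semireducible wrappers (as in the ★ `AbelianSchemes/*` files).
set_option backward.isDefEq.respectTransparency false

universe u

open CategoryTheory CategoryTheory.Limits AlgebraicGeometry MonoidalCategory
open scoped MonObj Obj

namespace Literature.AlgebraicGeometry.AbelianSchemes

namespace AbelianSchemeOver

open Literature.AlgebraicGeometry.Motives (AlgPoints specOver)

section RowsAtPointOfIsoBaseChange

variable {Y Y₂ : Scheme.{u}} {𝒜 ℬ : AbelianSchemeOver Y} {𝒜₂ : AbelianSchemeOver Y₂} {O : Type*} [CommRing O]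
  (ρ𝒜 : RingAction O 𝒜) (ρℬ : RingAction O ℬ) (ρ₂ : RingAction O 𝒜₂) (D𝒜 : 𝒜.DualPair) (Dℬ : ℬ.DualPair) (D₂ : 𝒜₂.DualPair)
  (hD𝒜 : Nonempty ((Scheme.Modules.pullback D𝒜.unitHatSlice).obj D𝒜.P ≅ SheafOfModules.unit _))
  (hDℬ : Nonempty ((Scheme.Modules.pullback Dℬ.unitHatSlice).obj Dℬ.P ≅ SheafOfModules.unit _))
  (hD₂ : Nonempty ((Scheme.Modules.pullback D₂.unitHatSlice).obj D₂.P ≅ SheafOfModules.unit _))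
  (pol𝒜 : 𝒜.Polarization D𝒜) (polℬ : ℬ.Polarization Dℬ) (pol₂ : 𝒜₂.Polarization D₂)
  {g n : ℕ} (lvl𝒜 : 𝒜.LevelStructure g n) (lvlℬ : ℬ.LevelStructure g n) (lvl₂ : 𝒜₂.LevelStructure g n)
  (𝔞 𝔟 : O → Prop) (ν : O) (N : ℕ) (c : 𝒜.X ⟶ ℬ.X) [IsMonHom c] (π : Y ⟶ Y₂)
  (E : ℬ.X ≅ (𝒜₂.baseChange π).X) [IsMonHom E.hom]
  {Ω : Type u} [Field Ω] (ℓ : Spec (.of Ω) ⟶ Y)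

include hD𝒜 hDℬ hD₂ in
/-- **THE GLOBAL SERRE-COVER ROWS THROUGH A GLOBAL EXACT ISOMORPHISM ONTO A BASE CHANGE, READ AT A FIELD POINT.**  Let `c : 𝒜 → ℬ` be a homomorphism of
abelian schemes over `Y` with the GLOBAL rows (t1) `∀ a ∈ 𝔞, ∃ d, c ≫ d = ρ𝒜(a) ∧ d ≫ c = ρℬ(a)`, (t1′) the kernel clause on ALL `T`-points over `Y`, (t2)
`∀ b ∈ 𝔟, ∃ f, c ≫ ρℬ(b) = f ≫ ρℬ(ν)`, (t3) `c ≫ λ_ℬ ≫ c^∨ = λ_𝒜 ≫ [N]`, (t4) equivariance, (t5) `σ_{ℬ,i} = σ_{𝒜,i} ≫ c`; let `π : Y → Y₂` and let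
`E : ℬ ≅ 𝒜₂ ×_{Y₂} π` be an isomorphism of group schemes over `Y` EXACT on the polarisations (`E ≫ (λ₂ ×_{Y₂} π) ≫ E^∨ = λ_ℬ`), on the actions
(`ρℬ(a) ≫ E = E ≫ (ρ₂(a) ×_{Y₂} π)`) and on the basis sections (`σ_{ℬ,i} ≫ E = (σ_{2,i}) ×_{Y₂} π`).  Then at every field point `ℓ : Spec Ω → Y` there is a
homomorphism `𝒜 ×_Y ℓ → 𝒜₂ ×_{Y₂} (ℓ ≫ π)` with the SEVEN point rows in the point readers of `𝒜` at `ℓ` and of `𝒜₂` at `ℓ ≫ π`.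
[cite: MumfordFogartyKirwan1994, Ch. 6 §1 Corollary 6.8 (p. 118) and Ch. 7 §2 Definition 7.2 (p. 129), Definition 7.3 (p. 130)] [cite: GortzWedhorn2020, Section (4.7) (pp. 107–108) and (4.15) (p. 116)]
[cite: Shimura1998, §13.1 Theorem 1 (pp. 97–99); §18.6 (pp. 124–127)] -/
theorem coverKer_rows_readAt_of_iso_baseChange
    (t1 : ∀ a, 𝔞 a → ∃ d : ℬ.X ⟶ 𝒜.X, c ≫ d = ρ𝒜.i a ∧ d ≫ c = ρℬ.i a)
    (t1' : ∀ ⦃T : Over Y⦄ (t : T ⟶ 𝒜.X), t ≫ c = 1 ↔ ∀ a, 𝔞 a → t ≫ ρ𝒜.i a = 1)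
    (t2 : ∀ b, 𝔟 b → ∃ f : 𝒜.X ⟶ ℬ.X, c ≫ ρℬ.i b = f ≫ ρℬ.i ν)
    (t3 : c ≫ polℬ.lam ≫ DualPair.dualIsogenyOver c D𝒜 Dℬ = pol𝒜.lam ≫ D𝒜.hat.mulN N)
    (t4 : ∀ a, ρ𝒜.i a ≫ c = c ≫ ρℬ.i a)
    (t5 : ∀ i, lvlℬ.σ i = lvl𝒜.σ i ≫ c)
    (hElam : E.hom ≫ (pol₂.baseChange π).lam ≫ DualPair.dualIsogenyOver E.hom Dℬ (D₂.baseChange π) = polℬ.lam)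
    (hEact : ∀ a, ρℬ.i a ≫ E.hom = E.hom ≫ baseChangeHom (ρ₂.i a) π)
    (hEsec : ∀ i, lvlℬ.σ i ≫ E.hom = (lvl₂.baseChange π).σ i) :
    ∃ (cℓ : (𝒜.baseChange ℓ).X ⟶ (𝒜₂.baseChange (ℓ ≫ π)).X) (_ : IsMonHom cℓ),
        (∀ a, 𝔞 a → ∃ d : (𝒜₂.baseChange (ℓ ≫ π)).X ⟶ (𝒜.baseChange ℓ).X,
          cℓ ≫ d = baseChangeHom (ρ𝒜.i a) ℓ ∧ d ≫ cℓ = baseChangeHom (ρ₂.i a) (ℓ ≫ π)) ∧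
        (∀ ⦃T : Literature.AlgebraicGeometry.Motives.SchemeOver Ω⦄ (t : T ⟶ (𝒜.baseChange ℓ).X),
          t ≫ cℓ = 1 ↔ ∀ a, 𝔞 a → t ≫ baseChangeHom (ρ𝒜.i a) ℓ = 1) ∧
        (∀ b, 𝔟 b → ∃ f : (𝒜.baseChange ℓ).X ⟶ (𝒜₂.baseChange (ℓ ≫ π)).X,
          cℓ ≫ baseChangeHom (ρ₂.i b) (ℓ ≫ π) = f ≫ baseChangeHom (ρ₂.i ν) (ℓ ≫ π)) ∧
        cℓ ≫ (pol₂.baseChange (ℓ ≫ π)).lam ≫ DualPair.dualIsogenyOver cℓ (D𝒜.baseChange ℓ) (D₂.baseChange (ℓ ≫ π)) =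
          (pol𝒜.baseChange ℓ).lam ≫ (D𝒜.baseChange ℓ).hat.mulN N ∧
        (∀ a, baseChangeHom (ρ𝒜.i a) ℓ ≫ cℓ = cℓ ≫ baseChangeHom (ρ₂.i a) (ℓ ≫ π)) ∧
        (∀ a : Fin g ⊕ Fin g → ZMod n,
          (AlgPoints.map cℓ (𝒜.restrictPt ℓ (lvl𝒜.section_ a)) : (𝒜₂.baseChange (ℓ ≫ π)).toAffine.toAbelianVariety.Points Ω) =
            𝒜₂.restrictPt (ℓ ≫ π) (lvl₂.section_ a)) := by
  classical
  -- (A) the global rows of `c`, read at `ℓ`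
  have hA := coverKer_rows_readAt ρ𝒜 ρℬ D𝒜 Dℬ pol𝒜 polℬ lvl𝒜 lvlℬ 𝔞 𝔟 ν N c ℓ t1 t1' t2 t3 t4 t5
  -- the Poincaré pins of all the base-changed dual pairs
  have h𝒜ℓ := DualPair.nonempty_unitHatSlice_baseChange_iso (g := ℓ) D𝒜 hD𝒜
  have hℬℓ := DualPair.nonempty_unitHatSlice_baseChange_iso (g := ℓ) Dℬ hDℬ
  have h₂πℓ := DualPair.nonempty_unitHatSlice_baseChange_iso (g := ℓ) (D₂.baseChange π) (DualPair.nonempty_unitHatSlice_baseChange_iso (g := π) D₂ hD₂)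
  have h₂ℓπ := DualPair.nonempty_unitHatSlice_baseChange_iso (g := ℓ ≫ π) D₂ hD₂
  -- the identity side's bookkeeping (`e := Iso.refl`: `(𝟙)^∨ = 𝟙`, `AlgPoints.map 𝟙 = id`)
  haveI : IsMonHom (Iso.refl (𝒜.baseChange ℓ).X).hom := (inferInstance : IsMonHom (𝟙 _))
  have h1 : DualPair.dualIsogenyOver (Iso.refl (𝒜.baseChange ℓ).X).hom (D𝒜.baseChange ℓ) (D𝒜.baseChange ℓ) = 𝟙 _ :=
    (DualPair.dualIsogenyOver_congr (D𝒜.baseChange ℓ) (D𝒜.baseChange ℓ) (ψ₁ := (Iso.refl (𝒜.baseChange ℓ).X).hom) (ψ₂ := 𝟙 _) (Iso.refl_hom _)).trans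
      (DualPair.dualIsogenyOver_id' (D𝒜.baseChange ℓ) h𝒜ℓ)
  have hrefl : (Iso.refl (𝒜.baseChange ℓ).X).hom ≫ (pol𝒜.baseChange ℓ).lam ≫
      DualPair.dualIsogenyOver (Iso.refl (𝒜.baseChange ℓ).X).hom (D𝒜.baseChange ℓ) (D𝒜.baseChange ℓ) = (pol𝒜.baseChange ℓ).lam := by
    rw [h1, Category.comp_id, Iso.refl_hom, Category.id_comp]
  -- (B) the global exact isomorphism `E`, base-changed to `ℓ`: still exact (functoriality of `(-) ×_Y ℓ`)
  let Eℓ : (ℬ.baseChange ℓ).X ≅ ((𝒜₂.baseChange π).baseChange ℓ).X := (Over.pullback ℓ).mapIso E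
  haveI hEℓmon : IsMonHom Eℓ.hom := isMonHom_baseChangeHom E.hom ℓ
  have hEℓlam : Eℓ.hom ≫ ((pol₂.baseChange π).baseChange ℓ).lam ≫
      DualPair.dualIsogenyOver Eℓ.hom (Dℬ.baseChange ℓ) ((D₂.baseChange π).baseChange ℓ) = (polℬ.baseChange ℓ).lam := by
    have h' := congrArg (fun f => (Over.pullback ℓ).map f) hElam
    simp only [Functor.map_comp] at h'
    have hd := DualPair.baseChangeHom_dualIsogenyOver_base ℓ E.hom Dℬ (D₂.baseChange π)
    change Eℓ.hom ≫ ((pol₂.baseChange π).baseChange ℓ).lam ≫ baseChangeHom (DualPair.dualIsogenyOver E.hom Dℬ (D₂.baseChange π)) ℓ = _ at h'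
    rw [hd] at h'
    exact h'
  have hEℓact : ∀ a, baseChangeHom (ρℬ.i a) ℓ ≫ Eℓ.hom = Eℓ.hom ≫ baseChangeHom (baseChangeHom (ρ₂.i a) π) ℓ := fun a => by
    have h' := congrArg (fun f => (Over.pullback ℓ).map f) (hEact a)
    simp only [Functor.map_comp] at h'
    exact h'
  have hEℓpt : ∀ a : Fin g ⊕ Fin g → ZMod n,
      (AlgPoints.map Eℓ.hom (ℬ.restrictPt ℓ (lvlℬ.section_ a)) : ((𝒜₂.baseChange π).baseChange ℓ).toAffine.toAbelianVariety.Points Ω) =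
        (𝒜₂.baseChange π).restrictPt ℓ ((lvl₂.baseChange π).section_ a) := fun a => by
    refine map_restrictPt_section_eq_of_baseChange_σ_comp ℓ lvlℬ (lvl₂.baseChange π) Eℓ.hom (fun i => ?_) a
    change (lvlℬ.baseChange ℓ).σ i ≫ baseChangeHom E.hom ℓ = _
    rw [LevelStructure.baseChange_σ, LevelStructure.baseChange_σ, sectionBaseChange_comp_baseChangeHom, hEsec i]
  have hB := coverKer_transport_along_iso (D𝒜.baseChange ℓ) (D𝒜.baseChange ℓ) (Dℬ.baseChange ℓ) ((D₂.baseChange π).baseChange ℓ)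
    h𝒜ℓ h𝒜ℓ hℬℓ h₂πℓ (pol𝒜.baseChange ℓ).lam (pol𝒜.baseChange ℓ).lam (polℬ.baseChange ℓ).lam ((pol₂.baseChange π).baseChange ℓ).lam
    (fun a => baseChangeHom (ρ𝒜.i a) ℓ) (fun a => baseChangeHom (ρ𝒜.i a) ℓ)
    (fun a => baseChangeHom (ρℬ.i a) ℓ) (fun a => baseChangeHom (baseChangeHom (ρ₂.i a) π) ℓ)
    (fun a : Fin g ⊕ Fin g → ZMod n => (𝒜.restrictPt ℓ (lvl𝒜.section_ a) : (𝒜.baseChange ℓ).toAffine.toAbelianVariety.Points Ω))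
    (fun a : Fin g ⊕ Fin g → ZMod n => (𝒜.restrictPt ℓ (lvl𝒜.section_ a) : (𝒜.baseChange ℓ).toAffine.toAbelianVariety.Points Ω))
    (fun a : Fin g ⊕ Fin g → ZMod n => (ℬ.restrictPt ℓ (lvlℬ.section_ a) : (ℬ.baseChange ℓ).toAffine.toAbelianVariety.Points Ω))
    (fun a : Fin g ⊕ Fin g → ZMod n =>
      ((𝒜₂.baseChange π).restrictPt ℓ ((lvl₂.baseChange π).section_ a) : ((𝒜₂.baseChange π).baseChange ℓ).toAffine.toAbelianVariety.Points Ω))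
    𝔞 𝔟 ν (Iso.refl _) Eℓ N
    hrefl
    hEℓlam (fun a => by simp only [Iso.refl_hom, Category.id_comp, Category.comp_id]) hEℓact
    (fun a => by rw [Iso.refl_hom, AlgPoints.map_id]; rfl) hEℓpt hA
  -- (C) the exact comparison isomorphism `(𝒜₂ ×_{Y₂} π) ×_Y ℓ ≅ 𝒜₂ ×_{Y₂} (ℓ ≫ π)`
  obtain ⟨e, hemon, -, -, helam, hesec, heact⟩ := exists_iso_of_tupleRel_id ((D₂.baseChange π).baseChange ℓ) (D₂.baseChange (ℓ ≫ π))
    (baseChangeHom (pol₂.baseChange π).lam ℓ) (pol₂.baseChange (ℓ ≫ π)).lam h₂ℓπ ((lvl₂.baseChange π).baseChange ℓ) (lvl₂.baseChange (ℓ ≫ π))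
    (fun a => baseChangeHom (baseChangeHom (ρ₂.i a) π) ℓ) (fun a => baseChangeHom (ρ₂.i a) (ℓ ≫ π))
    (tupleRel_baseChangeCompGrpIso_inv 𝒜₂ ρ₂ D₂ pol₂ lvl₂ π ℓ)
  haveI := hemon
  have hept : ∀ a : Fin g ⊕ Fin g → ZMod n,
      (AlgPoints.map e.hom ((𝒜₂.baseChange π).restrictPt ℓ ((lvl₂.baseChange π).section_ a)) :
          (𝒜₂.baseChange (ℓ ≫ π)).toAffine.toAbelianVariety.Points Ω) = 𝒜₂.restrictPt (ℓ ≫ π) (lvl₂.section_ a) := fun a =>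
    map_restrictPt_section_eq_of_baseChange_σ_comp₂ ℓ (ℓ ≫ π) (𝒜₂.baseChange π) 𝒜₂ (lvl₂.baseChange π) lvl₂ e.hom
      (fun i => by rw [LevelStructure.baseChange_σ, LevelStructure.baseChange_σ]; exact hesec i) a
  exact coverKer_transport_along_iso (D𝒜.baseChange ℓ) (D𝒜.baseChange ℓ) ((D₂.baseChange π).baseChange ℓ) (D₂.baseChange (ℓ ≫ π))
    h𝒜ℓ h𝒜ℓ h₂πℓ h₂ℓπ (pol𝒜.baseChange ℓ).lam (pol𝒜.baseChange ℓ).lam ((pol₂.baseChange π).baseChange ℓ).lam (pol₂.baseChange (ℓ ≫ π)).lam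
    (fun a => baseChangeHom (ρ𝒜.i a) ℓ) (fun a => baseChangeHom (ρ𝒜.i a) ℓ)
    (fun a => baseChangeHom (baseChangeHom (ρ₂.i a) π) ℓ) (fun a => baseChangeHom (ρ₂.i a) (ℓ ≫ π))
    (fun a : Fin g ⊕ Fin g → ZMod n => (𝒜.restrictPt ℓ (lvl𝒜.section_ a) : (𝒜.baseChange ℓ).toAffine.toAbelianVariety.Points Ω))
    (fun a : Fin g ⊕ Fin g → ZMod n => (𝒜.restrictPt ℓ (lvl𝒜.section_ a) : (𝒜.baseChange ℓ).toAffine.toAbelianVariety.Points Ω))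
    (fun a : Fin g ⊕ Fin g → ZMod n =>
      ((𝒜₂.baseChange π).restrictPt ℓ ((lvl₂.baseChange π).section_ a) : ((𝒜₂.baseChange π).baseChange ℓ).toAffine.toAbelianVariety.Points Ω))
    (fun a : Fin g ⊕ Fin g → ZMod n => (𝒜₂.restrictPt (ℓ ≫ π) (lvl₂.section_ a) : (𝒜₂.baseChange (ℓ ≫ π)).toAffine.toAbelianVariety.Points Ω))
    𝔞 𝔟 ν (Iso.refl _) e N
    hrefl
    helam (fun a => by simp only [Iso.refl_hom, Category.id_comp, Category.comp_id]) heact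
    (fun a => by rw [Iso.refl_hom, AlgPoints.map_id]; rfl) hept hB

end RowsAtPointOfIsoBaseChange

end AbelianSchemeOver

end Literature.AlgebraicGeometry.AbelianSchemes

end
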